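import Summits.QuantumFields.GaugeBoot.TiltedBoxSquareSlab
import Summits.QuantumFields.GaugeBoot.TiltedLatticeMidReflection
import HarnessLib

/-!
# The square tilted box of EVEN side: the in-plane link mirror `x_i ↦ 1 - x_i`, its two slabs and the half-space weights (gauge-boot, L3 negative supplement; twisted-slab mechanism, box geometry)

HONEST FRAMING (cell `pub-gaugeboot`, page 1 of every file): the venture produces certified bounds
on lattice expectations at stated coupling, gauge group, dimension and torus size; NOT a mass gap,
NOT a continuum limit, NOT a string tension; NOT Yang–Mills-summit-bearing (barriers
`FixedCouplingUltralocality`, `PerturbativeInvisibility`). Geometry for the NEGATIVE result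
`TiltedBoxEvenMidAxisRPNegative.lean` (in-plane LINK reflection positivity fails on the square tilted
box of even side in `d ≥ 3`), completing `TiltedBoxAxisRPNegative.lean` (even side, site mirror
`x_i ↦ -x_i`: the layer `x_i ≡ P` is moved) and `TiltedBoxOddAxisRPNegative.lean` (odd side, site
mirror: twisted slab).

On the square tilted box `ℤ^d / Γ(2P, 2P, L)` the coordinate `x_i` is defined modulo `2P`
(`axisCoord`). Every in-plane mirror `x_i ↦ c - x_i` has two fixed loci on `ℤ/2P`, and since
`2P e_i ≡ 2P e_j = T (mod Γ)` with `T ∉ Γ`, `2T ∈ Γ`, exactly ONE of them is twisted by the half-period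
translation `T` (`tiltedTwist`). For the link mirror `θ x = σ x + e_i` (`midReflect`, `σ = Θ_i` the
flip `tiltedAxisFlip`; on classes `x_i ↦ 1 - x_i`) the loci are the two slabs `x_i = ½` and
`x_i = P + ½`:

* **`tiltedAxisFlip_of_axisCoord_eq_zero`** / **`midReflect_of_axisCoord_eq_zero`**: on the layer
  `x_i ≡ 0`, `σ y = y` and `θ y = y + e_i` — the slab at `½` is reflected onto itself EXACTLY (the
  `i`-links based in the layer `0` are reversed in place);
* **`tiltedAxisFlip_of_axisCoord_eq_half`** / **`midReflect_of_axisCoord_eq_half`**: on the layer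
  `x_i ≡ P`, `σ y = y + T` and `θ y = y + e_i + T` — the slab at `P + ½` is TWISTED, exactly as the
  slab of the odd box (`TiltedBoxOddAxisGeometry.tiltedAxisFlip_of_axisCoord_eq`);
* `axisCoord_midReflect`: `x_i(θ y) = 1 - x_i(y)`; the closed half of the mirror is
  `Λ₊ = {1 ≤ x_i ≤ P}` (`InMidHalf P axisCoord`, the shape of `tiltedBox_linkRP`);
* the HALF-SPACE WEIGHTS `midWeight p ∈ {0, 1}` (`1` iff all four links of `p` lie in `Λ₊`, through
  `cTm`/`cLm` of the base layer) and the cancellation identity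
  **`midWeight_add_midWeight_plaqMidReflect`**: `c_p + c_{Θp} = 1` for every plaquette EXCEPT the
  plaquettes of the two slabs (`SquareSlab.IsSlabPlaq 0 ∨ SquareSlab.IsSlabPlaq P`, = the crossing
  plaquettes `IsMidCrossPlaq`, `isSlabPlaq_or_iff_isMidCrossPlaq`), where it is `0`;
  `isMidPosLink_of_midWeight_ne_zero`;
* general square-box facts used by the witness: `T ≠ 0`, `T + e_b ≠ 0` (`b ≠ i`), `e_j ≠ 0`,
  `e_k ≠ 0` (namespace `SquareBox`, every side `M`).

Everything is `[folklore]` bookkeeping (FILS 1980 §3 describes the box; the twist is elementary).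

References: J. Fröhlich, R. Israel, E. H. Lieb, B. Simon, J. Stat. Phys. 22 (1980) 297, §3;
K. Osterwalder, E. Seiler, Ann. Phys. 110 (1978) 440, §2; V. Kazakov, Z. Zheng,
arXiv:2203.11360 §3.1 (the link-plane RP family).
-/

noncomputable section

open QuotientAddGroup

namespace Summit.QuantumFields.GaugeBoot

namespace TiltedRP

/-! ## Non-vanishing classes of the square box of any side -/

namespace SquareBox

variable {d : ℕ} {i j : Fin d} {L M : ℕ}

/-- **`T ≠ 0`** on the square box of side `M ≥ 1`: `x_i + x_j = M` is not divisible by `2M`.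
[folklore] -/
theorem tiltedTwist_ne_zero [NeZero M] (hij : i ≠ j) :
    tiltedTwist d L M ≠ (0 : TiltedSite d i j M M L) := by
  have hM : M ≠ 0 := NeZero.ne M
  intro h
  rw [tiltedTwist, QuotientAddGroup.eq_zero_iff, mem_tiltedLattice_iff] at h
  obtain ⟨h1, -, -⟩ := h
  simp only [Pi.single_eq_of_ne hij, Pi.single_eq_same, zero_add] at h1
  have h2 := Int.le_of_dvd (Int.natCast_pos.2 (Nat.pos_of_ne_zero hM)) h1
  push_cast at h2; omega

/-- **`T + e_b ≠ 0` for `b ≠ i`** on the square box of side `M ≥ 2`: the class of `M e_j + e_b` has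
`x_i + x_j ∈ {M, M + 1}`, not divisible by `2M`. [folklore] -/
theorem tiltedTwist_add_unit_ne_zero (hM : 2 ≤ M) (hij : i ≠ j) {b : Fin d} (hb : b ≠ i) :
    tiltedTwist d L M + tiltedUnit d i j M M L b ≠ (0 : TiltedSite d i j M M L) := by
  intro h
  rw [tiltedTwist, tiltedUnit, ← QuotientAddGroup.mk_add, QuotientAddGroup.eq_zero_iff,
    mem_tiltedLattice_iff] at h
  obtain ⟨h1, -, -⟩ := h
  simp only [Pi.add_apply, Pi.single_eq_of_ne hij, Pi.single_eq_of_ne (Ne.symm hb), Pi.single_eq_same,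
    zero_add] at h1
  by_cases hbj : b = j
  · subst hbj
    rw [Pi.single_eq_same] at h1
    have h2 := Int.le_of_dvd (by omega) h1
    push_cast at h2; omega
  · rw [Pi.single_eq_of_ne (Ne.symm hbj), add_zero] at h1
    have h3 := Int.le_of_dvd (by omega) h1
    push_cast at h3; omega

/-- `e_j ≠ 0` in the square box of side `M ≥ 1`. [folklore] -/
theorem tiltedUnit_right_ne_zero [NeZero M] (hij : i ≠ j) :
    tiltedUnit d i j M M L j ≠ (0 : TiltedSite d i j M M L) := by
  have hM : M ≠ 0 := NeZero.ne M
  intro h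
  rw [tiltedUnit, QuotientAddGroup.eq_zero_iff, mem_tiltedLattice_iff] at h
  obtain ⟨h1, -, -⟩ := h
  simp only [Pi.single_eq_of_ne hij, Pi.single_eq_same, zero_add] at h1
  have h2 := Int.le_of_dvd one_pos h1
  push_cast at h2; omega

/-- `e_k ≠ 0` in the box for `k ∉ {i, j}` and `L ≥ 2`. [folklore] -/
theorem tiltedUnit_other_ne_zero {k : Fin d} (hki : k ≠ i) (hkj : k ≠ j) (hL : 2 ≤ L) :
    tiltedUnit d i j M M L k ≠ (0 : TiltedSite d i j M M L) := by
  intro h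
  rw [tiltedUnit, QuotientAddGroup.eq_zero_iff, mem_tiltedLattice_iff] at h
  obtain ⟨-, -, h3⟩ := h
  have h4 := h3 k hki hkj
  rw [Pi.single_eq_same] at h4
  have h5 := Int.le_of_dvd one_pos h4
  omega

end SquareBox

section Box

variable (d : ℕ) {i j : Fin d} (L P : ℕ)

/-! ## The two slabs of the link mirror: exact at `½`, twisted at `P + ½` -/

/-- **The twist lemma, even side**: on the layer `x_i ≡ P` of the box `Γ(2P, 2P, L)` the flip is the
half-period translation, `σ y = y + T` (`2P e_i ≡ 2P e_j (mod Γ)`; cf.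
`tiltedAxisFlip_layerSite`). [folklore] -/
theorem tiltedAxisFlip_of_axisCoord_eq_half (hij : i ≠ j) (q : TiltedSite d i j (2 * P) (2 * P) L)
    (hq : axisCoord d L (2 * P) q = ((P : ℕ) : ZMod (2 * P))) :
    tiltedAxisFlip d L (2 * P) hij q = q + tiltedTwist d L (2 * P) := by
  induction q using QuotientAddGroup.induction_on with
  | H x =>
    rw [axisCoord_mk] at hq
    have hdvd : (((2 * P : ℕ)) : ℤ) ∣ (P : ℤ) - x i := by
      rw [← ZMod.intCast_eq_intCast_iff_dvd_sub]; exact_mod_cast hq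
    obtain ⟨a, ha⟩ := hdvd
    rw [tiltedAxisFlip_mk, tiltedTwist, ← QuotientAddGroup.mk_add, QuotientAddGroup.eq, mem_tiltedLattice_iff]
    simp only [Pi.add_apply, Pi.neg_apply, negHom_apply, if_neg (Ne.symm hij), Pi.single_eq_same,
      Pi.single_eq_of_ne hij, if_true]
    have hxi : x i = (P : ℤ) - (2 * P : ℕ) * a := by linarith
    refine ⟨⟨1 - a, ?_⟩, ⟨-a, ?_⟩, fun k hki hkj => ?_⟩
    · rw [hxi]; push_cast; ring
    · rw [hxi]; push_cast; ring
    · rw [if_neg hki, Pi.single_eq_of_ne hkj]; simp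

/-- On the layer `x_i ≡ 0` the flip is the identity, `σ y = y` (`4P e_i ∈ Γ`). [folklore] -/
theorem tiltedAxisFlip_of_axisCoord_eq_zero (hij : i ≠ j) (q : TiltedSite d i j (2 * P) (2 * P) L)
    (hq : axisCoord d L (2 * P) q = 0) :
    tiltedAxisFlip d L (2 * P) hij q = q := by
  induction q using QuotientAddGroup.induction_on with
  | H x =>
    rw [axisCoord_mk, ZMod.intCast_zmod_eq_zero_iff_dvd] at hq
    obtain ⟨a, ha⟩ := hq
    rw [tiltedAxisFlip_mk, QuotientAddGroup.eq, mem_tiltedLattice_iff]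
    simp only [Pi.add_apply, Pi.neg_apply, negHom_apply, if_neg (Ne.symm hij), if_true]
    refine ⟨⟨a, ?_⟩, ⟨a, ?_⟩, fun k hki hkj => ?_⟩
    · rw [ha]; push_cast; ring
    · rw [ha]; push_cast; ring
    · rw [if_neg hki]; simp

/-- **The twisted slab**: on the layer `x_i ≡ P`, `θ y = y + T + e_i` for the link mirror
`θ = midReflect e i σ` — it carries the layer `P` onto the layer `P + 1` translated by `T`. [folklore] -/
theorem midReflect_of_axisCoord_eq_half (hij : i ≠ j) (q : TiltedSite d i j (2 * P) (2 * P) L)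
    (hq : axisCoord d L (2 * P) q = ((P : ℕ) : ZMod (2 * P))) :
    midReflect (tiltedUnit d i j (2 * P) (2 * P) L) i (tiltedAxisFlip d L (2 * P) hij) q =
      q + tiltedTwist d L (2 * P) + tiltedUnit d i j (2 * P) (2 * P) L i := by
  rw [midReflect, tiltedAxisFlip_of_axisCoord_eq_half d L P hij q hq]

/-- **The exact slab**: on the layer `x_i ≡ 0`, `θ y = y + e_i`. [folklore] -/
theorem midReflect_of_axisCoord_eq_zero (hij : i ≠ j) (q : TiltedSite d i j (2 * P) (2 * P) L)
    (hq : axisCoord d L (2 * P) q = 0) :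
    midReflect (tiltedUnit d i j (2 * P) (2 * P) L) i (tiltedAxisFlip d L (2 * P) hij) q =
      q + tiltedUnit d i j (2 * P) (2 * P) L i := by
  rw [midReflect, tiltedAxisFlip_of_axisCoord_eq_zero d L P hij q hq]

/-- `x_i(θ y) = -x_i(y) + 1` (`= 1 - x_i(y)`). [folklore] -/
theorem axisCoord_midReflect (hij : i ≠ j) (q : TiltedSite d i j (2 * P) (2 * P) L) :
    axisCoord d L (2 * P) (midReflect (tiltedUnit d i j (2 * P) (2 * P) L) i (tiltedAxisFlip d L (2 * P) hij) q) =
      -axisCoord d L (2 * P) q + 1 := by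
  rw [midReflect, map_add, axisCoord_tiltedAxisFlip, axisCoord_tiltedUnit_self]

/-- `val` of `x_i(σ y)`: `0 ↦ 0`, `c ↦ 2P - c`. [folklore] -/
theorem val_axisCoord_tiltedAxisFlip (hP : 2 ≤ P) (hij : i ≠ j) (q : TiltedSite d i j (2 * P) (2 * P) L) :
    (axisCoord d L (2 * P) (tiltedAxisFlip d L (2 * P) hij q)).val =
      if (axisCoord d L (2 * P) q).val = 0 then 0 else 2 * P - (axisCoord d L (2 * P) q).val := by
  rw [axisCoord_tiltedAxisFlip, val_neg hP]

/-- `val` of `x_i(θ y)`: `0 ↦ 1`, `1 ↦ 0`, `c ↦ 2P + 1 - c` for `c ≥ 2`. [folklore] -/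
theorem val_axisCoord_midReflect (hP : 2 ≤ P) (hij : i ≠ j) (q : TiltedSite d i j (2 * P) (2 * P) L) :
    (axisCoord d L (2 * P) (midReflect (tiltedUnit d i j (2 * P) (2 * P) L) i
      (tiltedAxisFlip d L (2 * P) hij) q)).val =
      if (axisCoord d L (2 * P) q).val ≤ 1 then 1 - (axisCoord d L (2 * P) q).val
      else 2 * P + 1 - (axisCoord d L (2 * P) q).val := by
  have hc := val_lt_two_mul hP (axisCoord d L (2 * P) q)
  rw [axisCoord_midReflect, val_add_one hP, val_neg hP]
  split_ifs <;> omega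

/-! ## The half-space weights of the plaquettes -/

/-- Weight of a TRANSVERSE plaquette (no `i`-side) inside the layer `x_i ≡ a`: `1` inside the closed
half `{1 ≤ x_i ≤ P}`, `0` outside. [folklore] -/
def cTm (a : ZMod (2 * P)) : ℝ := if 1 ≤ a.val ∧ a.val ≤ P then 1 else 0

/-- Weight of a LONGITUDINAL plaquette (with an `i`-side) between the layers `a` and `a + 1`: `1` if
both layers are in the closed half. [folklore] -/
def cLm (a : ZMod (2 * P)) : ℝ := if 1 ≤ a.val ∧ a.val + 1 ≤ P then 1 else 0

/-- `cTm(a) + cTm(1 - a) = 1`: the transverse plaquettes are exchanged between the two halves.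
[folklore] -/
theorem cTm_add_cTm_refl (hP : 2 ≤ P) (a : ZMod (2 * P)) : cTm P a + cTm P (-a + 1) = 1 := by
  unfold cTm
  have h1 := val_lt_two_mul hP a
  have h2 : (-a + 1).val = if a.val ≤ 1 then 1 - a.val else 2 * P + 1 - a.val := by
    rw [val_add_one hP, val_neg hP]; split_ifs <;> omega
  rw [h2]
  split_ifs <;> first | (norm_num; done) | (exfalso; omega)

/-- `cLm(a) + cLm(-a) = 1 - [a ∈ {0, P}]`: the longitudinal plaquettes are exchanged between the
halves, EXCEPT those of the two slabs (based in the layers `0` and `P`), which belong to neither.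
[folklore] -/
theorem cLm_add_cLm_neg (hP : 2 ≤ P) (a : ZMod (2 * P)) :
    cLm P a + cLm P (-a) = if a = 0 ∨ a = ((P : ℕ) : ZMod (2 * P)) then 0 else 1 := by
  unfold cLm
  have h1 := val_lt_two_mul hP a
  have h0 : a = 0 ↔ a.val = 0 := eq_zero_iff_val a
  have hPa : a = ((P : ℕ) : ZMod (2 * P)) ↔ a.val = P := eq_natCast_iff_val hP a
  rw [val_neg hP]
  by_cases ha : a = 0 ∨ a = ((P : ℕ) : ZMod (2 * P))
  · rw [if_pos ha]
    have ha' : a.val = 0 ∨ a.val = P := ha.imp h0.1 hPa.1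
    split_ifs <;> first | (norm_num; done) | (exfalso; omega)
  · rw [if_neg ha]
    have ha' : ¬ (a.val = 0 ∨ a.val = P) := fun h => ha (h.imp h0.2 hPa.2)
    split_ifs <;> first | (norm_num; done) | (exfalso; omega)

variable {d L P}

/-- **The half-space weight of a plaquette** of the even box for the link mirror: `cLm` of its base
layer if it has an `i`-side, `cTm` otherwise; it is `1` iff all four links lie in `{1 ≤ x_i ≤ P}`
and `0` otherwise. [folklore] -/
def midWeight (p : Plaq (TiltedSite d i j (2 * P) (2 * P) L) d) : ℝ :=
  if p.2.1.1 = i ∨ p.2.1.2 = i then cLm P (axisCoord d L (2 * P) p.1)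
  else cTm P (axisCoord d L (2 * P) p.1)

/-- **The cancellation identity**: `c_p + c_{Θ p} = 0` for the plaquettes of the two slabs (an
`i`-side, based in the layer `0` or `P`: `SquareSlab.IsSlabPlaq 0`, `SquareSlab.IsSlabPlaq P` — the
crossing plaquettes `IsMidCrossPlaq` of the link mirror), `= 1` for all others
(`Θ p = plaqMidReflect`). [folklore] -/
theorem midWeight_add_midWeight_plaqMidReflect (hP : 2 ≤ P) (hij : i ≠ j)
    (p : Plaq (TiltedSite d i j (2 * P) (2 * P) L) d) :
    midWeight p + midWeight (plaqMidReflect (tiltedUnit d i j (2 * P) (2 * P) L) i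
      (tiltedAxisFlip d L (2 * P) hij) p) =
      if SquareSlab.IsSlabPlaq 0 p ∨ SquareSlab.IsSlabPlaq ((P : ℕ) : ZMod (2 * P)) p then 0 else 1 := by
  unfold midWeight SquareSlab.IsSlabPlaq
  rw [plaqMidReflect_snd]
  by_cases hp : p.2.1.1 = i ∨ p.2.1.2 = i
  · have hp' : HasDir p i := hp
    rw [if_pos hp, if_pos hp, plaqMidReflect_fst_of_hasDir hp', axisCoord_tiltedAxisFlip, cLm_add_cLm_neg _ hP]
    by_cases ha : axisCoord d L (2 * P) p.1 = 0 ∨ axisCoord d L (2 * P) p.1 = ((P : ℕ) : ZMod (2 * P))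
    · rw [if_pos ha, if_pos (ha.imp (fun h => ⟨hp, h⟩) (fun h => ⟨hp, h⟩))]
    · rw [if_neg ha, if_neg (fun h => ha (h.imp (fun h => h.2) (fun h => h.2)))]
  · have hp' : ¬ HasDir p i := hp
    rw [if_neg hp, if_neg hp, plaqMidReflect_fst_of_not_hasDir hp', axisCoord_midReflect, cTm_add_cTm_refl _ hP,
      if_neg (fun h => hp (h.elim (fun h => h.1) (fun h => h.1)))]

/-- The slab plaquettes are the crossing plaquettes `IsMidCrossPlaq` of the link mirror (the tree's
name in `TiltedLinkRPPlaquettes.lean`). [folklore] -/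
theorem isSlabPlaq_or_iff_isMidCrossPlaq (hP : 2 ≤ P) (p : Plaq (TiltedSite d i j (2 * P) (2 * P) L) d) :
    (SquareSlab.IsSlabPlaq 0 p ∨ SquareSlab.IsSlabPlaq ((P : ℕ) : ZMod (2 * P)) p) ↔
      IsMidCrossPlaq i P (axisCoord d L (2 * P)) p := by
  unfold SquareSlab.IsSlabPlaq IsMidCrossPlaq HasDir
  rw [← eq_zero_iff_val, ← eq_natCast_iff_val hP]
  tauto

/-- A transverse plaquette of the layer `x_i ≡ P` has weight `1`. [folklore] -/
theorem midWeight_transverse (hP : 2 ≤ P) (q : DirPair d) (x : TiltedSite d i j (2 * P) (2 * P) L)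
    (hq1 : q.1.1 ≠ i) (hq2 : q.1.2 ≠ i) (hx : axisCoord d L (2 * P) x = ((P : ℕ) : ZMod (2 * P))) :
    midWeight ((x, q) : Plaq (TiltedSite d i j (2 * P) (2 * P) L) d) = 1 := by
  unfold midWeight cTm
  simp only [hq1, hq2, or_self, if_false, hx, val_natCast_self hP]
  rw [if_pos ⟨by omega, le_rfl⟩]

/-! ## Plaquettes of non-zero weight lie in the closed half -/

/-- One step inside the closed half: `x + e_k ∈ Λ₊` from `1 ≤ x_i(x) ≤ P` for `k ≠ i`, and from
`1 ≤ x_i(x)`, `x_i(x) + 1 ≤ P` for `k = i`. [folklore] -/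
theorem inMidHalf_add_tiltedUnit (hP : 2 ≤ P) {q : TiltedSite d i j (2 * P) (2 * P) L} {k : Fin d}
    (h : if k = i then 1 ≤ (axisCoord d L (2 * P) q).val ∧ (axisCoord d L (2 * P) q).val + 1 ≤ P
      else 1 ≤ (axisCoord d L (2 * P) q).val ∧ (axisCoord d L (2 * P) q).val ≤ P) :
    InMidHalf P (axisCoord d L (2 * P)) (q + tiltedUnit d i j (2 * P) (2 * P) L k) := by
  unfold InMidHalf
  rw [axisCoord_add_tiltedUnit]
  by_cases hk : k = i
  · rw [if_pos hk] at h ⊢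
    rw [val_add_one hP, if_neg (by omega)]
    omega
  · rw [if_neg hk] at h ⊢
    rw [add_zero]
    exact h

/-- **A plaquette with non-zero weight has all four links in the closed half** `{1 ≤ x_i ≤ P}`
(they are positive links of the link mirror, `IsMidPosLink`). [folklore] -/
theorem isMidPosLink_of_midWeight_ne_zero (hP : 2 ≤ P) {p : Plaq (TiltedSite d i j (2 * P) (2 * P) L) d}
    (hp : midWeight p ≠ 0) :
    let e := tiltedUnit d i j (2 * P) (2 * P) L
    IsMidPosLink e P (axisCoord d L (2 * P)) (p.1, p.2.1.1) ∧
    IsMidPosLink e P (axisCoord d L (2 * P)) (p.1 + e p.2.1.1, p.2.1.2) ∧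
    IsMidPosLink e P (axisCoord d L (2 * P)) (p.1 + e p.2.1.2, p.2.1.1) ∧
    IsMidPosLink e P (axisCoord d L (2 * P)) (p.1, p.2.1.2) := by
  intro e
  -- the base layer and the admissible moves
  have hbase : (1 ≤ (axisCoord d L (2 * P) p.1).val ∧ (axisCoord d L (2 * P) p.1).val ≤ P) ∧
      (∀ k, (k = p.2.1.1 ∨ k = p.2.1.2) →
        if k = i then 1 ≤ (axisCoord d L (2 * P) p.1).val ∧ (axisCoord d L (2 * P) p.1).val + 1 ≤ P
        else 1 ≤ (axisCoord d L (2 * P) p.1).val ∧ (axisCoord d L (2 * P) p.1).val ≤ P) := by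
    unfold midWeight at hp
    by_cases hd : p.2.1.1 = i ∨ p.2.1.2 = i
    · rw [if_pos hd] at hp
      unfold cLm at hp
      have hlt : 1 ≤ (axisCoord d L (2 * P) p.1).val ∧ (axisCoord d L (2 * P) p.1).val + 1 ≤ P := by
        by_contra h; exact hp (if_neg h)
      exact ⟨⟨hlt.1, by omega⟩, fun k _ => by by_cases hk : k = i <;> simp [hk, hlt]; omega⟩
    · rw [if_neg hd] at hp
      unfold cTm at hp
      have hle : 1 ≤ (axisCoord d L (2 * P) p.1).val ∧ (axisCoord d L (2 * P) p.1).val ≤ P := by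
        by_contra h; exact hp (if_neg h)
      refine ⟨hle, fun k hk => ?_⟩
      have hki : k ≠ i := by
        rcases hk with rfl | rfl
        · exact fun h => hd (Or.inl h)
        · exact fun h => hd (Or.inr h)
      simp [hki, hle]
  obtain ⟨h0, hmove⟩ := hbase
  have hk := hmove p.2.1.1 (Or.inl rfl)
  have hl := hmove p.2.1.2 (Or.inr rfl)
  -- all relevant vertices
  have v0 : InMidHalf P (axisCoord d L (2 * P)) p.1 := h0
  have v1 : InMidHalf P (axisCoord d L (2 * P)) (p.1 + e p.2.1.1) := inMidHalf_add_tiltedUnit hP hk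
  have v2 : InMidHalf P (axisCoord d L (2 * P)) (p.1 + e p.2.1.2) := inMidHalf_add_tiltedUnit hP hl
  have v12 : InMidHalf P (axisCoord d L (2 * P)) (p.1 + e p.2.1.1 + e p.2.1.2) := by
    refine inMidHalf_add_tiltedUnit hP ?_
    by_cases hli : p.2.1.2 = i
    · rw [if_pos hli]
      rw [if_pos hli] at hl
      have hki : p.2.1.1 ≠ i := fun h => (ne_of_lt p.2.2) (h.trans hli.symm)
      rw [if_neg hki] at hk
      rw [axisCoord_add_tiltedUnit, if_neg hki, add_zero]
      exact hl
    · rw [if_neg hli]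
      rw [if_neg hli] at hl
      by_cases hki : p.2.1.1 = i
      · rw [if_pos hki] at hk
        rw [axisCoord_add_tiltedUnit, if_pos hki, val_add_one hP, if_neg (by omega)]
        omega
      · rw [if_neg hki] at hk
        rw [axisCoord_add_tiltedUnit, if_neg hki, add_zero]
        exact hl
  have v21 : InMidHalf P (axisCoord d L (2 * P)) (p.1 + e p.2.1.2 + e p.2.1.1) := by
    rw [add_right_comm]; exact v12
  exact ⟨⟨v0, v1⟩, ⟨v1, v12⟩, ⟨v2, v21⟩, ⟨v0, v2⟩⟩

end Box

end TiltedRP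

end Summit.QuantumFields.GaugeBoot

end
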